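import Summits.QuantumFields.BalabanUV.Beta.D1BFx.CombColumnWindows
import Summits.QuantumFields.BalabanUV.Beta.D1BFx.PackedColumnEnvelope
import Summits.QuantumFields.BalabanUV.Beta.CombChartStepJets

/-!
# `BalabanUV.Beta.D1BFx.CombColumnEnvelope` — road «BF-x» ∕ the (III′) literal of record, binder row D1, slot (K), (J1) junction: **«GCOMB-COL-ENV» — THE
# n-EXPLICIT ENVELOPE OF THE COMB-CHART RESOLVENT's PACKED COLUMN `colH (GcombSh n 0) n` (`GcombSh n 0 = Πᵀ_{ρc} Π̂ᵀ_{sbm} K⁻¹ Π̂_{sbm} Π_{ρc}`, an2's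
# `CombChartStepJets.GcombSh` = the leg of the literal `JsB12CombShSym` ∕ `CombOneShotJets.JcOf`): `|colH (GcombSh n 0) n μ y κ u| ≤ n⁻⁴ · C · e^{−(κ′∕(4n))·|u − n•y|₁}`,
# UNCONDITIONAL — the SAME power and weight shape as the road's Π_bm-gauged column (g53 «G0-COL-ENV» `PackedColumnEnvelope.abs_colH_G₀_road_le`): the TWO
# column-side gauges (rooted comb `Π_{ρc}` after the block-mean-normalised symmetrised comb `Π̂_{sbm}`) cost ONE power of `n` JOINTLY, because the outer comb
# projector meets the inner gauge only through its values at the block ROOTS (part 1 `D1BFx/CombColumnWindows.colH_combDress_eq`)**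

HONEST DEPENDENCY (cell records, verbatim): «continuum YM on T⁴ ⇐ BetaPertH ∧ nine spine estimates (0/9 proved); BetaPertH ⇐ (D1) ∧ (D4) ∧
CAP+tail; G-an2-4 gates asym, D1 and NE2/3/4.»  HONEST FRAMING (cell contract, verbatim): «discharging `BetaPertH` makes Bałaban's UV stability
UNCONDITIONAL — a real constructive-QFT result; it is NOT the continuum limit and NOT the Clay problem.»  THIS MODULE DISCHARGES NOTHING of the
wall: [folklore] `ℓ^∞` envelope bookkeeping BY NAME over LANDED objects — part 1 `D1BFx/CombColumnWindows` (the comb-chart column identity), gan24-leaf-01's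
blockwise tree-gauge bound (`GAN24.DressedLegEnvelope.abs_treeGaugeAt_le_of_blockwise`), gan24-leaf-12's envelope wobble ∕ `ℓ¹` majorant (`GAN24.EnvelopeBlockSum.env_wobble` ∕
`env_le_exp_l1`), an1's `blk_block`, an2's `CombChartStepJets.GcombSh_apply` ∕ `SymmetrisedStepJets.Gsym_apply`, and g53's UNCONDITIONAL undressed column letter
`PackedColumnEnvelope.abs_colH_KInvStep_zero_le` (d1-formalise-leaf-05's `FP.CompositeMinimiserDecay.abs_wH_le`: `|wH| ≤ N^{−(d+2)}·MG163(d+1)·periodConst·e^{−(κ₁₆₃∕(d+1))‖⌊z∕N⌋ − q‖∞}`,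
d-only constants, NO printed hypothesis).  No definition, no `def … : Prop`, nothing cited, 0 sorry.  It is a WEIGHT LETTER, not a unit row: NO (1.22) count of any rest
word is proved here; (J1) is NOT touched (PART 22's `hC₁` stays OPEN); 0 root-level binders of row D1 discharged (hW ∕ hR-sockets ∕ hSX-socket ∕ D1Tel ∕ D1Rep = 0); (K) NOT
closed; NOT D1, NOT `BetaPertH`, NOT continuum, NOT Clay.

ABSOLUTE RULE (cell charter, verbatim): «No internally-minted statement may enter as a cited fact. Every hypothesis is either kernel-proved in
this package or a verbatim quotation of a PUBLISHED theorem with page reference. The manuscript(s) under audit are NOT citable for their own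
disputed steps — they are the thing under adjudication; programme-internal (2001/route/tribunal) claims are never citable.»

WHY (row owner an2 g42 RULING R-D1-g42-2; OWNER d1-p2 g21 `RELEG-SPEC.md` v0 §1 (L) «a `GcombSh n 0` column envelope with n-tracking — gan24-leaf-05's lane, NOT in the
tree», §3 «the chart-free prerequisites needed anyway ((L) envelope)»; OWNER FINDING F-g21-2 «(J1-γ) ABSORPTION»; d1-formalise-leaf-03 g27 WORD W-2 (b)∕(iii): under (γ)
the road's ROWS at `Jc := JcOf` are priced cheaply only by «a re-grouping of the lane words in which the dressing is carried by the leg inside each word … so that the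
lanes' inputs are `S⁰`'s n-free tables + `GcombSh`'s letters (`decays_GcombSh 0`, `shiftK_GcombSh 0` IN TREE; the column envelope with n-tracking NOT)»).  THE COUNT
BEHIND IT (this seat's ONLINE line, gen 56): the rooted projector's matrix `Π(b′, b) = (Π_ρ δ_b)(b′)` has ROW count up to `∼ N^d` (a spine bond's comb-downstream set has a
hyperplane boundary) but COLUMN count `≤ 1 + 2(d+1)N` — so the SAME dressing costs `N^d` read per stencil SLOT on the jets (the currency of the dressed literal's per-slot
mass table `mS`) and `N¹` read on the COLUMN, which is where an2's windowed adjunction `sum_tsum_mul_coProjAt` puts it; this file is that `N¹`, for BOTH comb gauges at once.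

CONTENT (generic `d`, in-block root `r ∈ box (d+1) N`, `1 ≤ N`; §2–§3 at the centred root of `GcombSh`).
* §1 [folklore] **`abs_colH_combDress_le_of_blockEnvelope`** (ANY packed kernel `K`): a block envelope `|colH K N μ y κ u| ≤ M·e^{−c‖⌊u∕N⌋−y‖∞}` (`M, c ≥ 0`) passes to the
  comb-chart-dressed column `colH (coDressKAt ρ N (coDressKSymAt ρ N K)) N μ y` with the factor `1 + 3(d+1)N(1 + e^{c})` — `1` the column, `(d+1)N(1+e^{c})` its two tree gauges,
  `2(d+1)N(1+e^{c})` the two root values of `σ^{sym}_bm` (part 1 §3), the unit shift wobbling the block label by at most one (`env_wobble`, factor `e^{c}`).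
* §2 [folklore] the ONE-SHOT instance **`abs_colH_GcombSh_zero_le_block`** (`≤ N^{−(d+2)}·C_d·(1 + 3(d+1)N(1+e^{c_d}))·e^{−c_d‖⌊u∕N⌋ − y‖∞}`, `C_d := MG163(d+1)·periodConst(κ₁₆₃(d+1), d)`,
  `c_d := κ₁₆₃(d+1)∕(d+1)`), **`abs_colH_GcombSh_zero_le_block'`** (the power displayed: `N^{−(d+1)}·C_d·(1 + 3(d+1)(1+e^{c_d}))`), **`abs_colH_GcombSh_zero_le_l1`** (fine `ℓ¹`
  currency, `·e^{c_d}·e^{−(c_d∕((d+1)N))|u − N•y|₁}`).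
* §3 [folklore, `d = 3`, `n = m + 1`] **`abs_colH_GcombSh_road_le`**: `∀ u, |colH (GcombSh n 0) n μ y κ u| ≤ (n⁴)⁻¹·(C₄·(1 + 12(1 + e^{κ′}))·e^{κ′})·e^{−(κ′∕(4n))·|u − n•y|₁}`,
  `C₄ := MG163 4·periodConst (kappa163 4) 3`, `κ′ := kappa163 4 ∕ 4` — EXACTLY the weight shape `hw` of `OneStepResolventKernel.biLoc_wsum` ∕ `PeriodicArrayWrapColH.colH_weight` ∕ the
  jets' mass letters and of g53's road letter (there `1 + 8(1 + e^{κ′})`); `colH_GcombSh_road_weight_nonneg`.  LOCATED COUNT: the (III′) literal's M-side packed weights are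
  `n⁻⁴ = n^{−(d+1)}`, one power above the undressed `wH^{(n)}`'s `n⁻⁵`, decaying on the block scale; unconditional; every two-column road word re-grouped onto the
  `GcombSh` leg (leaf-03 W-2 (iii)) keeps the powers it had on the `G₀^{bm}` leg.
NOT HERE (honest): the steps `j ≥ 1` (`GcombSh n j` dresses `KInvStep n j`, whose column is not `wH`); any (1.22) unit row; any statement about which of (α)∕(β)∕(γ) the row
adopts (an2's re-ruling); the fine-fine ∕ Ward letters of `GcombSh` (an2's `decays_GcombSh`, `CombChartHColumnWard.colH_ward_GcombSh` — IN TREE); anything of Bałaban's.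
Unit `b2b-balaban-gan24-formalise-leaf-05` (gen 56), G-an2-4 swarm leaf prover 05, road «BF-x» supplier (`colH`-weights lineage: `PeriodicArrayWrapColH` p317988,
`PackedColumnEnvelope` p326107, the (C2) `Coframe*` and (C3) `PackedAveraging*` ∕ `GhostQWordsScales` chains); INTENT «GCOMB-COL-ENV» (journal).  Not in print; our bookkeeping.
-/

noncomputable section

open Finset
open scoped BigOperators
open Literature.MathematicalPhysics.QuantumFieldTheory
open Literature.MathematicalPhysics.QuantumFieldTheory.LatticeForm (quo)
open Literature.MathematicalPhysics.QuantumFieldTheory.Balaban1983to89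
open Literature.MathematicalPhysics.QuantumFieldTheory.Balaban1983to89.Beta
open B12Sec2to5 (l1 l1_nonneg)
open B4ContourShift (supNorm supNorm_nonneg)
open B5Hk163Strip (kappa163 kappa163_pos)
open B5Hk163Decay (MG163)
open B4TorusKernel (periodConst)
open ExpKernelCalculus (MKer)
open AffineAveraging (Form0 Form1 Site box toSite unitVec unitVec_apply)
open AveragingContours (blk grad blk_block)
open AveragingContoursRooted (treeGaugeAt ctr ctrOff ctrOff_mem_box)
open RootedComb (axProjAt axProjAt_apply ctr_eq_toSite)
open OneStepResolventKernel (Fib)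
open OneStepKernelFamily (colH KInvStep)
open Summit.QuantumFields.BalabanUV.Beta.AxialDressingRooted (coDressKAt)
open Summit.QuantumFields.BalabanUV.Beta.SymmetrisedAxialGaugeBlockMean (symBmGaugeAt symAxProjBmAt)
open Summit.QuantumFields.BalabanUV.Beta.SymmetrisedDressingKernel (coDressKSymAt)
open Summit.QuantumFields.BalabanUV.Beta.GAN24.DressedLegEnvelope (abs_treeGaugeAt_le_of_blockwise)
open Summit.QuantumFields.BalabanUV.Beta.GAN24.EnvelopeBlockSum (env_wobble env_le_exp_l1)
open Summit.QuantumFields.BalabanUV.Beta.SymmetrisedStepJets (Gsym Gsym_apply)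
open Summit.QuantumFields.BalabanUV.Beta.CombChartStepJets (GcombSh GcombSh_apply)
open Summit.QuantumFields.BalabanUV.Beta.D1BFx.PackedColumnEnvelope (l1_unitVec_eq_one abs_colH_KInvStep_zero_le)
open Summit.QuantumFields.BalabanUV.Beta.D1BFx.CombColumnWindows (axProjAt_add_apply colH_combDress_eq abs_symBmGaugeAt_le_of_blockwise)

namespace Summit.QuantumFields.BalabanUV.Beta.D1BFx.CombColumnEnvelope

variable {d : ℕ}

/-! ## §1 The comb-chart-dressed column keeps a block-scale envelope at the cost of ONE power of `N` -/

section Envelope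

variable {N : ℕ} {r : Fin (d + 1) → ℕ}

/-- [folklore] **«GCOMB-COL-ENV», GENERIC FORM: THE COMB-CHART-DRESSED COLUMN KEEPS A BLOCK-SCALE ENVELOPE, AT THE COST OF ONE POWER OF `N`.**  If
`|colH K N μ y κ u| ≤ M·e^{−c‖⌊u∕N⌋ − y‖∞}` (`M, c ≥ 0`), then for every in-block root `r`
`|colH (coDressKAt (toSite r) N (coDressKSymAt (toSite r) N K)) N μ y κ u| ≤ M·(1 + 3(d+1)N·(1 + e^{c}))·e^{−c‖⌊u∕N⌋ − y‖∞}`: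
by §4's identity the column is `W − (λ_W(u+e_κ) − λ_W u) − (σ(root(u+e_κ)) − σ(root u))` with `|λ_W| ≤ (d+1)N·(envelope)` (gan24-leaf-01's
`abs_treeGaugeAt_le_of_blockwise`), `|σ| ≤ 2(d+1)N·(envelope)` (§3), the root of a block lies in the block (`blk_block`), and the unit shift wobbles the
block label by at most one (`env_wobble`, factor `e^{c}`). -/
theorem abs_colH_combDress_le_of_blockEnvelope (hN : 1 ≤ N) (hr : r ∈ box (d + 1) N) {K : MKer (d + 1) (Fib d)} {μ : Fin (d + 1)}
    {y : Site (d + 1)} {M c : ℝ} (hM : 0 ≤ M) (hc : 0 ≤ c)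
    (hK : ∀ κ u, |colH K N μ y κ u| ≤ M * Real.exp (-(c * supNorm (quo N u - y)))) (κ : Fin (d + 1)) (u : Site (d + 1)) :
    |colH (coDressKAt (toSite r) N (coDressKSymAt (toSite r) N K)) N μ y κ u|
      ≤ M * (1 + 3 * (((d : ℝ) + 1) * N) * (1 + Real.exp c)) * Real.exp (-(c * supNorm (quo N u - y))) := by
  rw [colH_combDress_eq hN hr K μ y κ u, axProjAt_apply]
  set W := colH K N μ y with hW
  set E : Site (d + 1) → ℝ := fun b => M * Real.exp (-(c * supNorm (b - y))) with hE
  have hWenv : ∀ κ' z, |W κ' z| ≤ E (blk N z) := fun κ' z => hK κ' z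
  have hE0 : ∀ b, 0 ≤ E b := fun b => mul_nonneg hM (Real.exp_pos _).le
  -- the shifted block label costs `e^{c}`
  have hEshift : E (blk N (u + unitVec κ)) ≤ Real.exp c * E (blk N u) := by
    have h := env_wobble (d := d) hN hc y u (u + unitVec κ)
    rw [add_sub_cancel_left, l1_unitVec_eq_one, mul_one] at h
    show M * Real.exp (-(c * supNorm (quo N (u + unitVec κ) - y))) ≤ Real.exp c * (M * Real.exp (-(c * supNorm (quo N u - y))))
    calc M * Real.exp (-(c * supNorm (quo N (u + unitVec κ) - y)))
        ≤ M * (Real.exp c * Real.exp (-(c * supNorm (quo N u - y)))) := mul_le_mul_of_nonneg_left h hM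
      _ = Real.exp c * (M * Real.exp (-(c * supNorm (quo N u - y)))) := by ring
  -- the roots lie in their blocks
  have hroot : ∀ z : Site (d + 1), blk N ((N : ℤ) • blk N z + toSite r) = blk N z := fun z => blk_block (blk N z) hr
  -- the five letters
  have h1 : |W κ u| ≤ E (blk N u) := hWenv κ u
  have h2 : |treeGaugeAt (toSite r) W N (u + unitVec κ)| ≤ (((d : ℝ) + 1) * N) * (Real.exp c * E (blk N u)) :=
    (abs_treeGaugeAt_le_of_blockwise hN hr (A := W) (S := E) hWenv (u + unitVec κ)).trans
      (mul_le_mul_of_nonneg_left hEshift (by positivity))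
  have h3 : |treeGaugeAt (toSite r) W N u| ≤ (((d : ℝ) + 1) * N) * E (blk N u) :=
    abs_treeGaugeAt_le_of_blockwise hN hr (A := W) (S := E) hWenv u
  have hcast : ((d + 1 : ℕ) : ℝ) = (d : ℝ) + 1 := by push_cast; ring
  have h4 : |symBmGaugeAt (toSite r) W N ((N : ℤ) • blk N (u + unitVec κ) + toSite r)| ≤ 2 * (((d : ℝ) + 1) * N * (Real.exp c * E (blk N u))) := by
    have h := abs_symBmGaugeAt_le_of_blockwise hN hr hE0 hWenv ((N : ℤ) • blk N (u + unitVec κ) + toSite r)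
    rw [hroot, hcast] at h
    exact h.trans (by gcongr)
  have h5 : |symBmGaugeAt (toSite r) W N ((N : ℤ) • blk N u + toSite r)| ≤ 2 * (((d : ℝ) + 1) * N * E (blk N u)) := by
    have h := abs_symBmGaugeAt_le_of_blockwise hN hr hE0 hWenv ((N : ℤ) • blk N u + toSite r)
    rwa [hroot, hcast] at h
  have hEu : E (blk N u) = M * Real.exp (-(c * supNorm (quo N u - y))) := rfl
  calc |W κ u - (treeGaugeAt (toSite r) W N (u + unitVec κ) - treeGaugeAt (toSite r) W N u)
          - (symBmGaugeAt (toSite r) W N ((N : ℤ) • blk N (u + unitVec κ) + toSite r)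
              - symBmGaugeAt (toSite r) W N ((N : ℤ) • blk N u + toSite r))|
      ≤ (|W κ u| + (|treeGaugeAt (toSite r) W N (u + unitVec κ)| + |treeGaugeAt (toSite r) W N u|))
          + (|symBmGaugeAt (toSite r) W N ((N : ℤ) • blk N (u + unitVec κ) + toSite r)|
              + |symBmGaugeAt (toSite r) W N ((N : ℤ) • blk N u + toSite r)|) := by
        refine (abs_sub _ _).trans (add_le_add ((abs_sub _ _).trans ?_) (abs_sub _ _))
        gcongr
        exact abs_sub _ _
    _ ≤ (E (blk N u) + ((((d : ℝ) + 1) * N) * (Real.exp c * E (blk N u)) + (((d : ℝ) + 1) * N) * E (blk N u)))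
          + (2 * (((d : ℝ) + 1) * N * (Real.exp c * E (blk N u))) + 2 * (((d : ℝ) + 1) * N * E (blk N u))) :=
        add_le_add (add_le_add h1 (add_le_add h2 h3)) (add_le_add h4 h5)
    _ = M * (1 + 3 * (((d : ℝ) + 1) * N) * (1 + Real.exp c)) * Real.exp (-(c * supNorm (quo N u - y))) := by
        rw [hEu]; ring

/-! ## §2 The one-shot comb-chart resolvent `GcombSh N 0` -/

/-- [folklore] **«GCOMB-COL-ENV» ON THE BLOCK SCALE, THE ONE-SHOT COMB-CHART RESOLVENT `G′₀ = GcombSh N 0 = Πᵀ_{ρc} Π̂ᵀ_{sbm} K⁻¹ Π̂_{sbm} Π_{ρc}`**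
(centred root; `1 ≤ N`): `|colH (GcombSh N 0) N μ y κ u| ≤ N^{−(d+2)}·C_d·(1 + 3(d+1)N(1 + e^{c_d}))·e^{−c_d‖⌊u∕N⌋ − y‖∞}`,
`C_d = MG163(d+1)·periodConst(κ₁₆₃(d+1), d)`, `c_d = κ₁₆₃(d+1)∕(d+1)` — g53's undressed column letter `abs_colH_KInvStep_zero_le` through §4. -/
theorem abs_colH_GcombSh_zero_le_block {N : ℕ} [NeZero N] (hN : 1 ≤ N) (μ : Fin (d + 1)) (y : Site (d + 1)) (κ : Fin (d + 1))
    (u : Site (d + 1)) :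
    |colH (GcombSh (d := d) N 0) N μ y κ u|
      ≤ ((N : ℝ) ^ (d + 2))⁻¹ * (MG163 (d + 1) * periodConst (kappa163 (d + 1)) d)
          * (1 + 3 * (((d : ℝ) + 1) * N) * (1 + Real.exp (kappa163 (d + 1) / ((d : ℝ) + 1))))
          * Real.exp (-(kappa163 (d + 1) / ((d : ℝ) + 1) * supNorm (quo N u - y))) := by
  have hM : 0 ≤ ((N : ℝ) ^ (d + 2))⁻¹ * (MG163 (d + 1) * periodConst (kappa163 (d + 1)) d) :=
    (mul_nonneg_iff_of_pos_right (Real.exp_pos _)).1 ((abs_nonneg _).trans (abs_colH_KInvStep_zero_le (d := d) hN μ y κ u))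
  have hc : 0 ≤ kappa163 (d + 1) / ((d : ℝ) + 1) := div_nonneg (kappa163_pos (d + 1)).le (by positivity)
  rw [GcombSh_apply, Gsym_apply, ctr_eq_toSite]
  exact abs_colH_combDress_le_of_blockEnvelope hN (ctrOff_mem_box hN) hM hc
    (fun κ' u' => abs_colH_KInvStep_zero_le (d := d) hN μ y κ' u') κ u

/-- [folklore] **«GCOMB-COL-ENV», THE POWER DISPLAYED**: `|colH (GcombSh N 0) N μ y κ u| ≤ N^{−(d+1)}·C_d·(1 + 3(d+1)(1 + e^{c_d}))·e^{−c_d‖⌊u∕N⌋ − y‖∞}` —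
ONE power of `N` above the undressed column `wH^{(N)}`, the SAME power as the road's `Π_bm`-gauged column (g53 `abs_colH_G0_le_block'`). -/
theorem abs_colH_GcombSh_zero_le_block' {N : ℕ} [NeZero N] (hN : 1 ≤ N) (μ : Fin (d + 1)) (y : Site (d + 1)) (κ : Fin (d + 1))
    (u : Site (d + 1)) :
    |colH (GcombSh (d := d) N 0) N μ y κ u|
      ≤ ((N : ℝ) ^ (d + 1))⁻¹ * ((MG163 (d + 1) * periodConst (kappa163 (d + 1)) d)
          * (1 + 3 * ((d : ℝ) + 1) * (1 + Real.exp (kappa163 (d + 1) / ((d : ℝ) + 1)))))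
          * Real.exp (-(kappa163 (d + 1) / ((d : ℝ) + 1) * supNorm (quo N u - y))) := by
  refine (abs_colH_GcombSh_zero_le_block (d := d) hN μ y κ u).trans ?_
  set C := MG163 (d + 1) * periodConst (kappa163 (d + 1)) d with hCdef
  set q := 1 + Real.exp (kappa163 (d + 1) / ((d : ℝ) + 1)) with hqdef
  have hN1 : (1 : ℝ) ≤ N := by exact_mod_cast hN
  have hN0 : (0 : ℝ) < N := by linarith
  have hC : 0 ≤ C := by
    have h0 : 0 ≤ ((N : ℝ) ^ (d + 2))⁻¹ * C :=
      (mul_nonneg_iff_of_pos_right (Real.exp_pos _)).1 ((abs_nonneg _).trans (abs_colH_KInvStep_zero_le (d := d) hN μ y κ u))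
    exact (mul_nonneg_iff_of_pos_left (inv_pos.mpr (pow_pos hN0 _))).1 h0
  have hq : 0 ≤ q := by positivity
  have hE := (Real.exp_pos (-(kappa163 (d + 1) / ((d : ℝ) + 1) * supNorm (quo N u - y)))).le
  refine mul_le_mul_of_nonneg_right ?_ hE
  have hpow : ((N : ℝ) ^ (d + 2))⁻¹ = ((N : ℝ) ^ (d + 1))⁻¹ * (N : ℝ)⁻¹ := by
    rw [pow_succ, mul_inv]
  rw [hpow]
  have hP1 : 0 ≤ ((N : ℝ) ^ (d + 1))⁻¹ := inv_nonneg.mpr (pow_nonneg hN0.le _)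
  have hkey : (N : ℝ)⁻¹ * (1 + 3 * (((d : ℝ) + 1) * N) * q) ≤ 1 + 3 * ((d : ℝ) + 1) * q := by
    have e : (N : ℝ)⁻¹ * (1 + 3 * (((d : ℝ) + 1) * N) * q) = (N : ℝ)⁻¹ + 3 * ((d : ℝ) + 1) * q := by
      field_simp
    rw [e]
    have hinvN : (N : ℝ)⁻¹ ≤ 1 := inv_le_one_of_one_le₀ hN1
    linarith
  calc ((N : ℝ) ^ (d + 1))⁻¹ * (N : ℝ)⁻¹ * C * (1 + 3 * (((d : ℝ) + 1) * N) * q)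
      = ((N : ℝ) ^ (d + 1))⁻¹ * C * ((N : ℝ)⁻¹ * (1 + 3 * (((d : ℝ) + 1) * N) * q)) := by ring
    _ ≤ ((N : ℝ) ^ (d + 1))⁻¹ * C * (1 + 3 * ((d : ℝ) + 1) * q) :=
        mul_le_mul_of_nonneg_left hkey (mul_nonneg hP1 hC)
    _ = ((N : ℝ) ^ (d + 1))⁻¹ * (C * (1 + 3 * ((d : ℝ) + 1) * q)) := by ring

/-- [folklore] **«GCOMB-COL-ENV» IN THE FINE `ℓ¹` CURRENCY** (the weight shape `hw` of `biLoc_wsum` ∕ `colH_weight` ∕ the jets' mass letters):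
`|colH (GcombSh N 0) N μ y κ u| ≤ N^{−(d+1)}·C_d·(1 + 3(d+1)(1 + e^{c_d}))·e^{c_d}·e^{−(c_d∕((d+1)N))·|u − N•y|₁}` (`env_le_exp_l1`). -/
theorem abs_colH_GcombSh_zero_le_l1 {N : ℕ} [NeZero N] (hN : 1 ≤ N) (μ : Fin (d + 1)) (y : Site (d + 1)) (κ : Fin (d + 1))
    (u : Site (d + 1)) :
    |colH (GcombSh (d := d) N 0) N μ y κ u|
      ≤ ((N : ℝ) ^ (d + 1))⁻¹ * ((MG163 (d + 1) * periodConst (kappa163 (d + 1)) d)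
          * (1 + 3 * ((d : ℝ) + 1) * (1 + Real.exp (kappa163 (d + 1) / ((d : ℝ) + 1)))) * Real.exp (kappa163 (d + 1) / ((d : ℝ) + 1)))
          * Real.exp (-(kappa163 (d + 1) / ((d : ℝ) + 1) / (((d : ℝ) + 1) * N)) * l1 (u - (N : ℤ) • y)) := by
  refine (abs_colH_GcombSh_zero_le_block' (d := d) hN μ y κ u).trans ?_
  have hc : 0 ≤ kappa163 (d + 1) / ((d : ℝ) + 1) := div_nonneg (kappa163_pos (d + 1)).le (by positivity)
  have h := env_le_exp_l1 (d := d) hN hc y u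
  have hN0 : (0 : ℝ) < N := by exact_mod_cast hN
  have hP1 : 0 ≤ ((N : ℝ) ^ (d + 1))⁻¹ := inv_nonneg.mpr (pow_nonneg hN0.le _)
  have hC : 0 ≤ (MG163 (d + 1) * periodConst (kappa163 (d + 1)) d)
      * (1 + 3 * ((d : ℝ) + 1) * (1 + Real.exp (kappa163 (d + 1) / ((d : ℝ) + 1)))) := by
    have h0 := (mul_nonneg_iff_of_pos_right (Real.exp_pos _)).1
      ((abs_nonneg _).trans (abs_colH_GcombSh_zero_le_block' (d := d) hN μ y κ u))
    exact (mul_nonneg_iff_of_pos_left (inv_pos.mpr (pow_pos hN0 _))).1 h0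
  calc ((N : ℝ) ^ (d + 1))⁻¹ * ((MG163 (d + 1) * periodConst (kappa163 (d + 1)) d)
          * (1 + 3 * ((d : ℝ) + 1) * (1 + Real.exp (kappa163 (d + 1) / ((d : ℝ) + 1)))))
          * Real.exp (-(kappa163 (d + 1) / ((d : ℝ) + 1) * supNorm (quo N u - y)))
      ≤ ((N : ℝ) ^ (d + 1))⁻¹ * ((MG163 (d + 1) * periodConst (kappa163 (d + 1)) d)
          * (1 + 3 * ((d : ℝ) + 1) * (1 + Real.exp (kappa163 (d + 1) / ((d : ℝ) + 1)))))
          * (Real.exp (kappa163 (d + 1) / ((d : ℝ) + 1))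
            * Real.exp (-(kappa163 (d + 1) / ((d : ℝ) + 1) / (((d : ℝ) + 1) * N)) * l1 (u - (N : ℤ) • y))) :=
        mul_le_mul_of_nonneg_left h (mul_nonneg hP1 hC)
    _ = _ := by ring

/-! ## §3 `d = 3`: the (III′) literal's packed weights `colH (GcombSh n 0) n`, `n = m + 1`, in the weight shape of the road's rows -/

/-- [folklore] **«GCOMB-COL-ENV» FOR THE (III′) LITERAL OF RECORD** (`d = 3`, block side `n = m + 1`, centred root, ANY coarse bond `(μ, y)`, ANY fine direction `κ`):
`∀ u, |colH (GcombSh n 0) n μ y κ u| ≤ (n⁴)⁻¹·(C₄·(1 + 12(1 + e^{κ′}))·e^{κ′})·e^{−(κ′∕(4n))·|u − n•y|₁}`, `C₄ = MG163 4·periodConst (kappa163 4) 3`,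
`κ′ = kappa163 4 ∕ 4` — THE LOCATED COUNT `n⁻⁴`, UNCONDITIONAL: the same power and the same weight shape as the road's `Π_bm`-gauged column
(g53 `PackedColumnEnvelope.abs_colH_G₀_road_le`, there `1 + 8(1 + e^{κ′})`). -/
theorem abs_colH_GcombSh_road_le (m : ℕ) (μ : Fin (3 + 1)) (y : Fin (3 + 1) → ℤ) (κ : Fin (3 + 1)) :
    ∀ u : Fin (3 + 1) → ℤ, |colH (GcombSh (d := 3) (m + 1) 0) (m + 1) μ y κ u|
      ≤ ((((m + 1 : ℕ) : ℝ) ^ 4)⁻¹ * ((MG163 4 * periodConst (kappa163 4) 3)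
          * (1 + 12 * (1 + Real.exp (kappa163 4 / 4))) * Real.exp (kappa163 4 / 4)))
        * Real.exp (-(kappa163 4 / 4 / (4 * ((m + 1 : ℕ) : ℝ))) * l1 (u - ((m + 1 : ℕ) : ℤ) • y)) := by
  intro u
  have h := abs_colH_GcombSh_zero_le_l1 (d := 3) (N := m + 1) (Nat.le_add_left 1 m) μ y κ u
  have e3 : ((3 : ℕ) : ℝ) + 1 = 4 := by norm_num
  simp only [e3] at h
  have e12 : (3 : ℝ) * 4 = 12 := by norm_num
  rw [e12] at h
  exact h

/-- [folklore] The (III′) literal's weight constant is nonnegative (for the `hC` slots of `biLoc_wsum`-type lemmas). -/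
theorem colH_GcombSh_road_weight_nonneg (m : ℕ) :
    0 ≤ ((((m + 1 : ℕ) : ℝ) ^ 4)⁻¹ * ((MG163 4 * periodConst (kappa163 4) 3)
          * (1 + 12 * (1 + Real.exp (kappa163 4 / 4))) * Real.exp (kappa163 4 / 4))) := by
  have h := abs_colH_GcombSh_road_le m 0 0 0 0
  exact (mul_nonneg_iff_of_pos_right (Real.exp_pos _)).1 ((abs_nonneg _).trans h)

end Envelope

end Summit.QuantumFields.BalabanUV.Beta.D1BFx.CombColumnEnvelope

end
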